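import Summits.ABC.ABC.Theses.IneffectiveSubspace

/-!
# `DeepRegimeABC` (stmt-ABC-15121): every deep cell is inhabited, and `ε` cannot be dropped on any cell

Negative-side support lemmas for the crux `Summit.ABC.ABC.Theses.IneffectiveSubspace.DeepRegimeABC`
(abc on an `ε`-dependent deep tail `{ω₅(abc) ≥ K(ε)}`, `ω₅(n) := #{p : p⁵ ∣ n}`), from the refuter's
crux attack (2026-08-16):

* `le_card_deep_of_dvd`, `deepRegimeABC_cell_nonempty` — for every `K` the cell `{ω₅(abc) ≥ K}` contains
  an abc triple, namely `(1, N⁵ − 1, N⁵)` with `N = 2·p₀⋯p_{K−1}`; so no choice of the threshold `K`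
  meets the crux vacuously.
* `deepCell_no_uniform_constant`, `deepRegimeABC_false_without_eps` — Granville–Tucker's `ε = 0`
  example run INSIDE each cell: for every `K` and every real `C` the triple `(1, N^{5n} − 1, N^{5n})`,
  `n = φ(r²)` for a prime `r > C·N`, lies in the cell and has `C·rad(abc) < c` (Euler gives
  `r² ∣ N^{5n} − 1`, whence `rad(abc)·r ≤ N·b`). Hence the exponent `1 + ε` of the crux cannot be
  replaced by `1` on any deep cell, with any constant: any proof must use `ε > 0`, exactly as for abc
  itself (`Literature.Barriers.ABC.not_abc_epsilon_zero` is the cell `K = 0`).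
-/

namespace Summit.ABC.ABC.Theorems.DeepRegimeABC.Negative

open Literature.NumberTheory.DiophantineGeometry UniqueFactorizationMonoid

/-- A prime `p` with `p⁵ ∣ n ≠ 0` is counted by `ω₅(n)`. [folklore] -/
theorem mem_deep_of_pow_dvd {n p : ℕ} (hn : n ≠ 0) (hp : p.Prime) (h : p ^ 5 ∣ n) :
    p ∈ n.primeFactors.filter (fun p => 5 ≤ n.factorization p) := by
  rw [Finset.mem_filter, Nat.mem_primeFactors]
  exact ⟨⟨hp, dvd_trans (dvd_pow_self p (by norm_num)) h, hn⟩,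
    (hp.pow_dvd_iff_le_factorization hn).mp h⟩

/-- If the first `K` primes divide `N` and `N⁵ ∣ n ≠ 0`, then `ω₅(n) ≥ K`. [folklore] -/
theorem le_card_deep_of_dvd {K N n : ℕ} (hn : n ≠ 0)
    (hdvdN : ∀ i ∈ Finset.range K, Nat.nth Nat.Prime i ∣ N) (hNn : N ^ 5 ∣ n) :
    K ≤ (n.primeFactors.filter (fun p => 5 ≤ n.factorization p)).card := by
  have himg : (Finset.range K).image (Nat.nth Nat.Prime) ⊆
      n.primeFactors.filter (fun p => 5 ≤ n.factorization p) := by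
    intro p hp
    obtain ⟨i, hi, rfl⟩ := Finset.mem_image.mp hp
    exact mem_deep_of_pow_dvd hn (Nat.prime_nth_prime i)
      (dvd_trans (pow_dvd_pow_of_dvd (hdvdN i hi) 5) hNn)
  have hinj : Set.InjOn (Nat.nth Nat.Prime) (Finset.range K : Set ℕ) :=
    (Nat.nth_injective Nat.infinite_setOf_prime).injOn
  calc K = (Finset.range K).card := (Finset.card_range K).symm
    _ = ((Finset.range K).image (Nat.nth Nat.Prime)).card :=
        (Finset.card_image_of_injOn hinj).symm
    _ ≤ _ := Finset.card_le_card himg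

/-- The modulus `N_K := 2 · p₀ p₁ ⋯ p_{K−1}`: at least `2`, and divisible by each of the first `K`
primes. [folklore] -/
theorem deepModulus_spec (K : ℕ) :
    2 ≤ 2 * ∏ i ∈ Finset.range K, Nat.nth Nat.Prime i ∧
      ∀ i ∈ Finset.range K, Nat.nth Nat.Prime i ∣ 2 * ∏ i ∈ Finset.range K, Nat.nth Nat.Prime i := by
  have hPpos : 0 < ∏ i ∈ Finset.range K, Nat.nth Nat.Prime i :=
    Finset.prod_pos fun i _ => (Nat.prime_nth_prime i).pos
  refine ⟨?_, fun i hi => dvd_mul_of_dvd_right (Finset.dvd_prod_of_mem _ hi) 2⟩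
  have : 2 * 1 ≤ 2 * ∏ i ∈ Finset.range K, Nat.nth Nat.Prime i := Nat.mul_le_mul_left 2 hPpos
  simpa using this

/-- **Every deep cell is inhabited.** For every `K` there is an abc triple `(a, b, c)` with
`ω₅(abc) ≥ K`: `(1, N⁵ − 1, N⁵)` with `N = 2·p₀⋯p_{K−1}`. So the threshold `∃ K` of
`DeepRegimeABC` can never be met vacuously. [folklore] -/
theorem deepRegimeABC_cell_nonempty (K : ℕ) :
    ∃ a b c : ℕ, IsABCTriple a b c ∧
      K ≤ ((a * b * c).primeFactors.filter (fun p => 5 ≤ (a * b * c).factorization p)).card := by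
  obtain ⟨h2N, hdvdN⟩ := deepModulus_spec K
  set N : ℕ := 2 * ∏ i ∈ Finset.range K, Nat.nth Nat.Prime i with hN
  have hc : 2 ≤ N ^ 5 := le_trans h2N (Nat.le_self_pow (by norm_num) N)
  refine ⟨1, N ^ 5 - 1, N ^ 5, ⟨one_pos, by omega, by omega, Nat.coprime_one_left _⟩, ?_⟩
  have hne : 1 * (N ^ 5 - 1) * N ^ 5 ≠ 0 :=
    Nat.mul_ne_zero (Nat.mul_ne_zero one_ne_zero (by omega)) (by positivity)
  exact le_card_deep_of_dvd hne hdvdN (dvd_mul_left _ _)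

/-- Arithmetic core (Granville–Tucker's example with a general base): if `r` is prime and `r² ∣ b`
with `b > 0`, then `rad(1 · b · M^m) · r ≤ M · b` for every `M > 0` — indeed
`rad(b · M^m) ∣ M · (b / r)`. [cite: GranvilleTucker2002, p. 1227] -/
theorem rad_mul_prime_le_of_sq_dvd_base {r b M : ℕ} (m : ℕ) (hr : r.Prime) (hb : 0 < b)
    (hM : 0 < M) (hrb : r ^ 2 ∣ b) : rad 1 b (M ^ m) * r ≤ M * b := by
  obtain ⟨t, ht⟩ := hrb
  have ht0 : 0 < t := by
    rcases Nat.eq_zero_or_pos t with h | h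
    · subst h; simp [ht] at hb
    · exact h
  have hbr : b / r = r * t := by
    rw [ht, pow_two, mul_assoc, Nat.mul_div_cancel_left _ hr.pos]
  have hk : M * (b / r) ≠ 0 := by
    rw [hbr]; exact Nat.mul_ne_zero hM.ne' (Nat.mul_ne_zero hr.ne_zero ht0.ne')
  have hdvd : radical (1 * b * M ^ m) ∣ M * (b / r) := by
    rw [Nat.radical_dvd_iff hk]
    intro q hq
    rw [Nat.mem_primeFactors] at hq ⊢
    obtain ⟨hqprime, hqdvd, -⟩ := hq
    refine ⟨hqprime, ?_, hk⟩
    rw [hbr]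
    rcases (Nat.Prime.dvd_mul hqprime).mp hqdvd with h | h
    · have hqb : q ∣ r ^ 2 * t := by simpa [ht] using h
      rcases (Nat.Prime.dvd_mul hqprime).mp hqb with h1 | h1
      · have := (Nat.prime_dvd_prime_iff_eq hqprime hr).mp (hqprime.dvd_of_dvd_pow h1)
        subst this
        exact dvd_mul_of_dvd_right (dvd_mul_right q t) M
      · exact dvd_mul_of_dvd_right (dvd_mul_of_dvd_right h1 r) M
    · exact dvd_mul_of_dvd_left (hqprime.dvd_of_dvd_pow h) _
  have hle : radical (1 * b * M ^ m) ≤ M * (b / r) := Nat.le_of_dvd (Nat.pos_of_ne_zero hk) hdvd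
  have hdiv : b / r * r = b := Nat.div_mul_cancel ⟨r * t, by rw [ht]; ring⟩
  calc rad 1 b (M ^ m) * r = radical (1 * b * M ^ m) * r := rfl
    _ ≤ M * (b / r) * r := Nat.mul_le_mul_right r hle
    _ = M * b := by rw [mul_assoc, hdiv]

/-- **`ε = 0` fails on every deep cell, for every constant.** For every `K` and every real `C` there
is an abc triple with `ω₅(abc) ≥ K` and `C · rad(abc) < c`: take `N = 2·p₀⋯p_{K−1}`, a prime
`r > C·N` (so `r ∤ N`), `n = φ(r²)`, and the triple `(1, N^{5n} − 1, N^{5n})`; Euler gives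
`r² ∣ N^{5n} − 1`, so `rad(abc) ≤ N·b/r < b/C`. [cite: GranvilleTucker2002, p. 1227] -/
theorem deepCell_no_uniform_constant (K : ℕ) (C : ℝ) :
    ∃ a b c : ℕ, IsABCTriple a b c ∧
      K ≤ ((a * b * c).primeFactors.filter (fun p => 5 ≤ (a * b * c).factorization p)).card ∧
      C * (rad a b c : ℝ) < c := by
  obtain ⟨h2N, hdvdN⟩ := deepModulus_spec K
  set N : ℕ := 2 * ∏ i ∈ Finset.range K, Nat.nth Nat.Prime i with hN
  have hNpos : 0 < N := by omega
  -- a prime r > C·N with r > N, hence r ∤ N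
  obtain ⟨r, hr_ge, hr⟩ := Nat.exists_infinite_primes (⌈C * N⌉₊ + N + 1)
  have hrN : N < r := by omega
  have hndvd : ¬ r ∣ N := fun h => absurd (Nat.le_of_dvd hNpos h) (not_le.mpr hrN)
  have hcopNr : Nat.Coprime N r :=
    (Nat.coprime_comm).mp ((Nat.Prime.coprime_iff_not_dvd hr).mpr hndvd)
  have hcop : Nat.Coprime (N ^ 5) (r ^ 2) := (hcopNr.pow_right 2).pow_left 5
  set n := Nat.totient (r ^ 2) with hn
  have hmod : (N ^ 5) ^ n ≡ 1 [MOD r ^ 2] := Nat.ModEq.pow_totient hcop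
  have hn0 : 0 < n := Nat.totient_pos.mpr (pow_pos hr.pos 2)
  have hN5 : 2 ≤ N ^ 5 := le_trans h2N (Nat.le_self_pow (by norm_num) N)
  have h2le : 2 ≤ (N ^ 5) ^ n := le_trans hN5 (Nat.le_self_pow hn0.ne' _)
  have hpb : r ^ 2 ∣ (N ^ 5) ^ n - 1 := (Nat.modEq_iff_dvd' (by omega)).mp hmod.symm
  set b := (N ^ 5) ^ n - 1 with hb
  have hb_pos : 0 < b := by omega
  have hb_lt : b < (N ^ 5) ^ n := by omega
  refine ⟨1, b, (N ^ 5) ^ n, ⟨one_pos, hb_pos, by omega, Nat.coprime_one_left b⟩, ?_, ?_⟩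
  · -- depth: the K primes of N are 5-deep in abc = 1 · b · (N⁵)^n
    have hne : 1 * b * (N ^ 5) ^ n ≠ 0 :=
      Nat.mul_ne_zero (Nat.mul_ne_zero one_ne_zero hb_pos.ne') (by positivity)
    exact le_card_deep_of_dvd hne hdvdN (dvd_mul_of_dvd_right (dvd_pow_self _ hn0.ne') _)
  · -- size: rad · r ≤ N · b and r > C·N
    have key : rad 1 b ((N ^ 5) ^ n) * r ≤ N * b := by
      have := rad_mul_prime_le_of_sq_dvd_base (5 * n) hr hb_pos hNpos hpb
      simpa [pow_mul] using this
    have keyR : (rad 1 b ((N ^ 5) ^ n) : ℝ) * r ≤ (N : ℝ) * b := by exact_mod_cast key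
    have hr_pos : (0 : ℝ) < r := by exact_mod_cast hr.pos
    have hrC : C * N < r := by
      have h1 := Nat.le_ceil (C * N)
      have h2 : ((⌈C * (N : ℝ)⌉₊ + N + 1 : ℕ) : ℝ) ≤ r := by exact_mod_cast hr_ge
      push_cast at h2
      linarith
    have hbR : (0 : ℝ) < b := by exact_mod_cast hb_pos
    have hbltR : (b : ℝ) < (((N ^ 5) ^ n : ℕ) : ℝ) := by exact_mod_cast hb_lt
    rcases le_or_gt C 0 with hC | hC
    · calc C * (rad 1 b ((N ^ 5) ^ n) : ℝ) ≤ 0 :=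
            mul_nonpos_of_nonpos_of_nonneg hC (Nat.cast_nonneg _)
        _ < b := hbR
        _ < (((N ^ 5) ^ n : ℕ) : ℝ) := hbltR
    · have hrad : (rad 1 b ((N ^ 5) ^ n) : ℝ) ≤ N * b / r := by
        rw [le_div_iff₀ hr_pos]; exact keyR
      have hratio : C * N / r < 1 := by
        rw [div_lt_one hr_pos]; exact hrC
      calc C * (rad 1 b ((N ^ 5) ^ n) : ℝ) ≤ C * (N * b / r) := by gcongr
        _ = (C * N / r) * b := by ring
        _ < 1 * b := by gcongr
        _ = b := one_mul _
        _ < (((N ^ 5) ^ n : ℕ) : ℝ) := hbltR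

/-- **Any proof of `DeepRegimeABC` must use `ε > 0`** (natural strengthening refuted): the crux with
the exponent `1 + ε` replaced by `1` — "beyond some depth threshold `K` a single constant `C` gives
`c < C · rad(abc)`" — is false, for every `K` and every `C`.  The cell `K = 0` is
`Literature.Barriers.ABC.not_abc_epsilon_zero`. [cite: GranvilleTucker2002, p. 1227] -/
theorem deepRegimeABC_false_without_eps :
    ¬ ∃ K : ℕ, ∃ C : ℝ, ∀ a b c : ℕ, IsABCTriple a b c →
        K ≤ ((a * b * c).primeFactors.filter (fun p => 5 ≤ (a * b * c).factorization p)).card →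
        (c : ℝ) < C * (rad a b c : ℝ) := by
  rintro ⟨K, C, hKC⟩
  obtain ⟨a, b, c, ht, hK, hlt⟩ := deepCell_no_uniform_constant K C
  exact absurd (hKC a b c ht hK) (not_lt.mpr hlt.le)

end Summit.ABC.ABC.Theorems.DeepRegimeABC.Negative
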